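/-
Copyright: b2b-lace cell (CriticalPhenomena). The W3-G(b) INSTANTIATION module (build `lace`, lean1 thread,
2026-08-26), written to the LEAD's word W-18b (HOME STATUS row l.5015
`carver-g64:W-18b-WORD-W3-G(b)-INSTANTIATION-NobleWeightedRawSumsBound-lean1-thread`) from the pre-wording
`carver/g62/census/W18b-PREWORDING.md` (59661598457868d4) §1–§3; kind PROOF (theorems only); no numeral; d-generic;
no cited hypothesis; no `𝐞` abbreviation is declared.
-/
import Literature.Probability.FitznerVanDerHofstad2017.NobleWeightedSlotGlue
import Literature.Probability.FitznerVanDerHofstad2017.NobleWeightedCaseA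
import Literature.Probability.FitznerVanDerHofstad2017.NobleWeightedRbRows
import Literature.Probability.FitznerVanDerHofstad2017.NobleWeightedDiagRight
import Literature.Probability.FitznerVanDerHofstad2017.NobleWeightedDiagLeft
import Literature.Probability.FitznerVanDerHofstad2017.NobleWeightedOffDiagRight
import Literature.Probability.FitznerVanDerHofstad2017.NobleWeightedOffDiagLeft
import HarnessLib

/-!
# [FvdH17] Lemma 5.1 VERSION 2 (raw): the one-side-trivial sums `R_R`, `R_L` of the percolation letters bounded by
# the landed class bounds (slot instantiation)

CITATION HEADER (PLACEMENT v2). This module is part of a certified REPRODUCTION of: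
R. Fitzner, R. van der Hofstad, *Mean-field behavior for nearest-neighbor percolation in `d > 10`*, Electron. J.
Probab. **22** (2017) no. 43 [FvdH17] (arXiv:1506.07977v2): §4.4 (4.65) (p. 43, the weighted diagram `Ξ^{(1)}`),
Lemma 5.1 second version (p. 50, the bound with the two one-side-trivial sums `R_R`, `R_L` carried raw), §6.1 (p. 59)
and App. C.1 of the extended version (pp. 79–80: the case split of the right-trivial diagram by the position of `u, w`
— Cases a)–d), (C.2)–(C.5) — and the left-trivial one "in the same way").  Origin: build `lace` (host summit
CriticalPhenomena); node N76-XI1DELTA ∕ W3, desk object W3-G(b) (instantiation) of the LEAD (carver-g62 pre-wording;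
LEAD word W-18b), filed by the lean1 thread.

WHAT THIS FILE DOES (all `d`-generic; no percolation event is opened here, no inequality between letters is proved
here, no numeral).  It INSTANTIATES the two slot-assembly theorems of `NobleWeightedSlotGlue` — `rawR_le_of_slots`
(seven ι-summed slots: class `0` whole; classes `1, 2` split into the rows `w = 0`, the diagonal `x = w ≠ 0` and the
off-diagonal remainder) and `rawL_le_of_slots` (five ι-summed slots: class `0` whole; classes `1, 2` split into the
diagonal `t = e_ι` and its complement) — at the percolation letters `L := Letters.perc d p` (`Sn := blockPSn L`,
`Ab := blockAbar' L`, `En := blockPEn L`), filling every slot with a LANDED class bound of the tree, right-hand side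
VERBATIM:
* `R_R` (`perc_rawR_le`): class `0` ← `NobleBlocks.perc_sum_rawRPiece_zero_le` (`NobleWeightedCaseA`, Case a));
  rows `w = 0` ← `NobleBlocks.sum_rawRPieceAt0_one_le` ∕ `_two_le` (`NobleWeightedRbRows`, Case b)); diagonal ←
  `perc_sum_rawRDiag_one_le ι₀` ∕ `perc_sum_rawRDiag_two_le` (`NobleWeightedDiagRight`); off-diagonal ←
  `perc_sum_rawROffDiag_one_le ι₀` ∕ `perc_sum_rawROffDiag_two_le` (`NobleWeightedOffDiagRight`, Cases c), d)).  The
  class-`1` diagonal and off-diagonal bounds are evaluated at a fixed direction `e_{ι₀}` (the `W_d`-symmetry of those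
  modules), so `ι₀ : Fin d × Bool` is a parameter of the theorem.
* `R_L` (`perc_rawL_le`): class `0` ← `NobleBlocks.perc_sum_rawLPiece_zero_le` (`NobleWeightedCaseA`); diagonal
  class `1` ← the per-direction bound `perc_rawLDiag_one_le ι` (`NobleWeightedDiagLeft`) summed over `ι`
  (`Finset.sum_le_sum`); diagonal class `2` ← the inner-split IDENTITY `perc_sum_rawLDiag_two_inner_split`
  (`NobleWeightedDiagLeft`) read as an upper bound by dropping the carried NEGATIVE cross term on the left
  (`le_self_add`): the slot is `Σ_y K̃(y)·(LW₂ + TT₂)(y) + 2·Σ_ι Σ_y p·τ_{≥1}(y + e_ι)·CrossPos₂(ι, y)` with print's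
  un-separated POSITIVE cross term CARRIED INSIDE the slot expression, unpriced (packet DIVERGENCE D98 ∕ C1′: its
  pricing is a certificate-layer matter, not decided or used here); off-diagonal class `1` ← the per-direction bound
  `perc_rawLOffDiag_one_le ι` (`NobleWeightedOffDiagLeft`) summed over `ι`; off-diagonal class `2` ←
  `perc_sum_rawLOffDiag_two_le_sup` (`NobleWeightedOffDiagLeft`).
Each proof is the one-line application of the slot theorem to the landed leaves (plus the two `Finset.sum_le_sum`
steps and the one `le_self_add.trans_eq` step named above).  D98-neutral: App. C.1 is cited as the source of the
index pattern of the OFF-DIAGONAL bounds and of the case split by the position of `u, w` only; the diagonal addends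
carry their own one-bond letters (GAPS G-D98); no docstring asserts an inequality between an App. C.1 letter and a
row letter.  Nothing landed is modified; no cited hypothesis — both statements are kernel-proved inequalities between
the tree's objects; the unit-vector map `stepVec` is written out in full (no file-local abbreviation).
-/

noncomputable section

namespace Literature.Probability.FitznerVanDerHofstad2017

open scoped BigOperators ENNReal
open Literature.Probability.LatticeModels Literature.Probability.Percolation
open Literature.Probability.FitznerVanDerHofstad2017.BlockSummation
open Literature.Probability.FitznerVanDerHofstad2017.NobleBlocks

variable {d : ℕ}

section Perc

variable (p : unitInterval)

/-! ## A. Right side trivial: `R_R` of the percolation letters -/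

/-- **`R_R` bounded by the landed class bounds** ([FvdH17] Lemma 5.1 second version, the right-trivial sum; App. C.1
Cases a)–d)): `rawR (blockPSn L) (blockAbar' L) ≤ FA + (FB₁ + FΔ₁ + FO₁) + (FB₂ + FΔ₂ + FO₂)` at `L = Letters.perc d p`,
where `FA` is the right-hand side of `NobleBlocks.perc_sum_rawRPiece_zero_le` (class `0`, Case a)), `FB₁, FB₂` those
of `NobleBlocks.sum_rawRPieceAt0_one_le` ∕ `_two_le` (rows `w = 0`, Case b)), `FΔ₁, FΔ₂` those of
`perc_sum_rawRDiag_one_le ι₀` ∕ `perc_sum_rawRDiag_two_le` (diagonal `x = w ≠ 0`, one-bond letters), and `FO₁, FO₂`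
those of `perc_sum_rawROffDiag_one_le ι₀` ∕ `perc_sum_rawROffDiag_two_le` (off-diagonal, Cases c), d)) — all
verbatim; `ι₀` is the fixed direction at which the class-`1` bounds are evaluated.  Proof: `rawR_le_of_slots` applied
to the seven landed leaves.
[cite: FitznerVanDerHofstad2017, Lemma 5.1 second version (arXiv:1506.07977v2 p. 50); §4.4 (4.65) (p. 43); App. C.1 (C.2)–(C.5) (pp. 79–80)] -/
theorem perc_rawR_le (ι₀ : Fin d × Bool) :
    rawR (blockPSn (Letters.perc d p)) (blockAbar' (Letters.perc d p)) ≤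
      (letterHD (Letters.perc d p) 1 * (∑ ι : Fin d × Bool, ∑' s, blockAbar' (Letters.perc d p) ι 0 0 0 0 s s) +
          (∑' w, (Letters.perc d p).D (.ge 1) (.ge 1) w) * letterH (Letters.perc d p) 2 0) +
      ((letterHsup (Letters.perc d p) 2 * ∑' u, kdc u 0 * (Letters.perc d p).B (.ge 3) (.eq 1) u 0) +
        ((2 * d : ℝ≥0∞) * ((ENNReal.ofReal p *
            ∑ ι : Fin d × Bool, (Letters.perc d p).tau (.ge 1) (stepVec ι₀ - stepVec ι)) *
          (ENNReal.ofReal p * wtOpenBubbleAt (Letters.perc d p) (stepVec ι₀)))) +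
        (2 * ((2 * d : ℝ≥0∞) * (offMidSum (Letters.perc d p) (stepVec ι₀) *
            (ENNReal.ofReal p * wtOpenBubbleAt (Letters.perc d p) (stepVec ι₀)))) +
          2 * (letterHT₁ (Letters.perc d p) 2 (stepVec ι₀) * ((2 * d : ℝ≥0∞) * (ENNReal.ofReal p *
            openBubbleAt (Letters.perc d p) (stepVec ι₀)))))) +
      ((letterHsup (Letters.perc d p) 2 * ∑' u, kdc u 0 * (Letters.perc d p).D (.ge 2) (.ge 2) u) +
        (ENNReal.ofReal p * ∑' y, (∑ ι : Fin d × Bool, (Letters.perc d p).tau (.ge 1) (y - stepVec ι)) *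
          ((Letters.perc d p).tau (.ge 2) y * wtOpenBubbleAt (Letters.perc d p) y)) +
        (2 * (∑' s, (Letters.perc d p).tau (.ge 2) s * offMidSum (Letters.perc d p) s *
            wtOpenBubbleAt (Letters.perc d p) s) +
          2 * (∑' u, ∑' w, (kdc u 0 * kdc w 0 * (Letters.perc d p).T (.ge 1) (.ge 2) (.ge 1) u w 0) *
            letterHT₁ (Letters.perc d p) 2 (u - w)))) := by
  refine rawR_le_of_slots (blockPSn (Letters.perc d p)) (blockAbar' (Letters.perc d p))
    (perc_sum_rawRPiece_zero_le p) (sum_rawRPieceAt0_one_le p) (perc_sum_rawRDiag_one_le p ι₀) ?_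
    (sum_rawRPieceAt0_two_le p) (perc_sum_rawRDiag_two_le p) (perc_sum_rawROffDiag_two_le p)
  exact perc_sum_rawROffDiag_one_le p ι₀

/-! ## B. Left side trivial: `R_L` of the percolation letters -/

/-- **`R_L` bounded by the landed class bounds** ([FvdH17] Lemma 5.1 second version, the left-trivial sum; App. C.1
"in the same way"): `rawL (blockAbar' L) (blockPEn L) ≤ GA + (GΔ₁ + GO₁) + (GΔ₂ + GO₂)` at `L = Letters.perc d p`,
where `GA` is the right-hand side of `NobleBlocks.perc_sum_rawLPiece_zero_le` (class `0`), `GΔ₁` the ι-sum of the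
per-direction right-hand sides of `perc_rawLDiag_one_le ι` (diagonal `t = e_ι`, class `1`), `GO₁` the ι-sum of those
of `perc_rawLOffDiag_one_le ι` (off-diagonal, class `1`), `GΔ₂` the right-hand side of the inner-split identity
`perc_sum_rawLDiag_two_inner_split` (diagonal, class `2`) — `Σ_y K̃(y)·(LW₂ + TT₂)(y)` PLUS the carried positive
cross term `2·Σ_ι Σ_y p·τ_{≥1}(y + e_ι)·CrossPos₂(ι, y)`, kept INSIDE the bound unpriced (the identity's negative cross
term on the left is dropped by `le_self_add`; D98 ∕ C1′: no pricing of the cross term is asserted) — and `GO₂` the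
right-hand side of `perc_sum_rawLOffDiag_two_le_sup` (off-diagonal, class `2`), all verbatim.  Proof:
`rawL_le_of_slots` applied to the five landed leaves (two `Finset.sum_le_sum`, one `le_self_add.trans_eq`).
[cite: FitznerVanDerHofstad2017, Lemma 5.1 second version (arXiv:1506.07977v2 p. 50); §4.4 (4.65) (p. 43); App. C.1 (C.1) and the left-trivial sentence (pp. 79–80)] -/
theorem perc_rawL_le :
    rawL (blockAbar' (Letters.perc d p)) (blockPEn (Letters.perc d p)) ≤
      (letterH (Letters.perc d p) 2 0 * (∑' w, (Letters.perc d p).D (.ge 1) (.ge 1) w) +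
          (∑ ι : Fin d × Bool, ∑' t, blockAbar' (Letters.perc d p) ι 0 0 0 0 t t) * letterHD (Letters.perc d p) 1) +
      ((∑ ι : Fin d × Bool, ∑' y, kdc (y + stepVec ι) 0 *
            ((Letters.perc d p).tau (.eq 1) y * (Letters.perc d p).tau (.ge 2) (y + stepVec ι)) *
          diagLWTT (Letters.perc d p) (.eq 1) ι y) +
        (∑ ι : Fin d × Bool,
          (2 * (∑' s, (Letters.perc d p).tau (.eq 1) s * diagLTT (Letters.perc d p) (.eq 1) s *
              wtOpenBubbleAt (Letters.perc d p) (s + stepVec ι)) +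
            2 * (∑' s, (Letters.perc d p).tau (.eq 1) s * diagWTB (Letters.perc d p) s *
              openBubbleAt (Letters.perc d p) (s + stepVec ι))))) +
      ((∑' y, diagKtilde (Letters.perc d p) y *
              (diagLW (Letters.perc d p) (.ge 2) y + diagLTT (Letters.perc d p) (.ge 2) y) +
            2 * ∑ ι : Fin d × Bool, ∑' y, (ENNReal.ofReal p * (Letters.perc d p).tau (.ge 1) (y + stepVec ι)) *
              diagLCrossPos (Letters.perc d p) (.ge 2) ι y) +
        (2 * (wtKBubbleSup (Letters.perc d p) * ∑' s, diagLTT (Letters.perc d p) (.ge 2) s) +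
          2 * (∑' s, (Letters.perc d p).tau (.ge 2) s * wtOpenBubbleAt (Letters.perc d p) s *
            kBubbleAt (Letters.perc d p) s))) := by
  refine rawL_le_of_slots (blockAbar' (Letters.perc d p)) (blockPEn (Letters.perc d p))
    (perc_sum_rawLPiece_zero_le p) ?_ ?_ ?_ (perc_sum_rawLOffDiag_two_le_sup p)
  · exact Finset.sum_le_sum fun ι _ => perc_rawLDiag_one_le p ι
  · exact Finset.sum_le_sum fun ι _ => perc_rawLOffDiag_one_le p ι
  · exact le_self_add.trans_eq (perc_sum_rawLDiag_two_inner_split p)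

end Perc

end Literature.Probability.FitznerVanDerHofstad2017

end
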